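import Mathlib
import Literature.Geometry.Lorentzian.ReggeWheelerTortoise
import Summits.FinalStateConjecture.FinalStateConjecture.Theorems.PhotonSphereChannelsUniformPhotonSphereChannelsRShiftFromCoeffsSeries

/-!
# Crux `UniformPhotonSphereChannelsR` (K1R, stmt-FinalStateConjecture-14074), line
# `crum-peeling-recessive-tower` — stub `stub_shiftFromCoeffs` (Theorems B+D: the shift bounds)

The registered stub `stub_shiftFromCoeffs` of the line's skeleton v4: the division-free two-sided
bounds on the last recessive Riccati variable `W` (with `W' = U − W²`) of the far Regge–Wheeler
chain, from the coefficient data of its series representation.  The lead supplies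
`W = −(1/r) · 𝛚(M/r)` with `𝛚(w) = ∑ Ωₙ wⁿ`, its inverse series `𝐠 = ∑ Gₙ wⁿ`
(`∑ᵢ Gᵢ Ω_{n−i} = [n = 0]`), and the bounds `|G₁| ≤ R`, `|Gₙ| ≤ Rⁿ⁻¹` (`n ≥ 2`), `|Ωₙ| ≤ Rⁿ` on a
half-line where `r ≥ 200 R M`.  Writing `D = −1/W = r · 𝐠(w)`, `w = M/r ≤ 1/(200R)`:

* `sfc_hasDerivAt_D` : `D' = (1 − 2w) · 𝒟𝐠(w)` with `𝒟𝐠 = 𝐠 − w 𝐠' = ∑ (1 − n) Gₙ wⁿ`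
  (`dr/dx = 1 − 2M/r`, `dw/dx = −(w/r)(1 − 2w)`);
* `sfc_hasDerivAt_D₁` : `D'' = (w/r)(1 − 2w)(2 𝒟𝐠(w) − (1 − 2w) 𝒟𝐠'(w))`;
* `sfc_translate` : `D > 0`, `D' ≤ 1`, `1 − D' ≤ 1/64`, `D'' ≥ 0` give, for `W = −1/D` and
  `U = W' + W² = (1 + D')/D²`, the clauses `W < 0`, `U ≤ 2W²`, `W² ≤ 2(U − W²)`,
  `64(2W² − U) ≤ W²`, `4W(U − W²) − U' = −(2D'(1 − D') + D''D)/D³ ≤ 0`;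
* `stub_shiftFromCoeffs` : the registered signature, from the point package `sfc_point` of part 1
  (`|𝐠(w) − 1| ≤ 1/100`, `|𝒟𝐠(w) − 1| ≤ w/100`, `|𝒟𝐠'(w)| ≤ 1/50`) and the Cauchy product
  `𝐠 · 𝛚 = 1` (`sfc_tsum_mul_tsum_eq_one`).
-/

-- `Summit.<S>.<S>` repeats a namespace component by design (D-0017); off here as in the lakefile.
set_option linter.dupNamespace false

noncomputable section

open Literature.Geometry.Lorentzian Literature.Geometry.Lorentzian.ReggeWheeler MeasureTheory
open Filter Set Topology
open scoped ENNReal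

namespace Summit.FinalStateConjecture.FinalStateConjecture.Theorems.CrumPeelingRecessiveTower

/-! ### `D = r · 𝐠(M/r)` and `D' = (1 − 2M/r) · 𝒟𝐠(M/r)` along a tortoise radius function -/

section Calculus

variable {M : ℝ} {r : ℝ → ℝ} {xc : ℝ}

/-- `d/dx (M / r) = −M (1 − 2M/r) / r²` along a tortoise radius function. -/
theorem sfc_hasDerivAt_w (hr : IsTortoiseRadius M r xc) (x : ℝ) :
    HasDerivAt (fun y => M / r y) ((0 * r x - M * (1 - 2 * M / r x)) / r x ^ 2) x :=
  (hasDerivAt_const x M).div (hr.hasDerivAt x) (hr.pos x).ne'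

/-- **`D' = (1 − 2w) 𝒟𝐠(w)`**, `w = M/r`: if `g` has derivative `g₁` at `w(x)` and
`dg (w x) = g (w x) − w x · g₁`, then `D = r · g(M/r)` has derivative `(1 − 2 w x) · dg (w x)` at
`x`. -/
theorem sfc_hasDerivAt_D (hr : IsTortoiseRadius M r xc) (g dg : ℝ → ℝ) {x g₁ : ℝ}
    (hg : HasDerivAt g g₁ (M / r x)) (hrel : dg (M / r x) = g (M / r x) - M / r x * g₁) :
    HasDerivAt (fun y => r y * g (M / r y)) ((1 - 2 * (M / r x)) * dg (M / r x)) x := by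
  have hrx : r x ≠ 0 := (hr.pos x).ne'
  refine ((hr.hasDerivAt x).mul (hg.comp x (sfc_hasDerivAt_w hr x))).congr_deriv ?_
  rw [hrel]
  simp only [Function.comp_def]
  field_simp
  ring

/-- **`D'' = (w/r)(1 − 2w)(2 𝒟𝐠(w) − (1 − 2w) 𝒟𝐠'(w))`**: the derivative of
`D' = (1 − 2M/r) · dg(M/r)` at `x` when `dg` has derivative `d₁` at `w(x) = M/r(x)`. -/
theorem sfc_hasDerivAt_D₁ (hr : IsTortoiseRadius M r xc) (dg : ℝ → ℝ) {x d₁ : ℝ}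
    (hdg : HasDerivAt dg d₁ (M / r x)) :
    HasDerivAt (fun y => (1 - 2 * (M / r y)) * dg (M / r y))
      (M / r x / r x * (1 - 2 * (M / r x)) * (2 * dg (M / r x) - (1 - 2 * (M / r x)) * d₁)) x := by
  have hrx : r x ≠ 0 := (hr.pos x).ne'
  have hw := sfc_hasDerivAt_w hr x
  have h1 : HasDerivAt (fun y => 1 - 2 * (M / r y))
      (0 - 2 * ((0 * r x - M * (1 - 2 * M / r x)) / r x ^ 2)) x :=
    (hasDerivAt_const x (1 : ℝ)).sub (hw.const_mul 2)
  refine (h1.mul (hdg.comp x hw)).congr_deriv ?_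
  simp only [Function.comp_def]
  field_simp
  ring

end Calculus

/-! ### From `D > 0`, `1/2 ≤ D' ≤ 1`, `1 − D' ≤ 1/64`, `D'' ≥ 0` to the clauses on `W = −1/D` -/

/-- **Translation to the Riccati variables.**  On `(X, ∞)` let `D > 0` have derivative `D₁`, let
`W = −1/D` solve `W' = U − W²`; at a point `x > X` let `D₁` have a derivative `d₂ ≥ 0` and
`D₁ x ≤ 1`, `1 − D₁ x ≤ 1/64` (so `D₁ x ≥ 1/2`).  Then `W x < 0`, `U x ≤ 2 W x²`,
`W x² ≤ 2 (U x − W x²)`,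
`64 (2 W x² − U x) ≤ W x²`, and `U` is differentiable at `x` with `4 W (U − W²) − U' ≤ 0` there
(`U = (1 + D₁)/D²`, `4W(U − W²) − U' = −(2 D₁ (1 − D₁) + d₂ D)/D³`). -/
theorem sfc_translate {D D₁ W U : ℝ → ℝ} {X x d₂ : ℝ} (hx : X < x)
    (hD : ∀ y, X < y → HasDerivAt D (D₁ y) y) (hpos : ∀ y, X < y → 0 < D y)
    (hW : ∀ y, X < y → W y = -1 / D y) (hWU : ∀ y, X < y → HasDerivAt W (U y - W y ^ 2) y)
    (hD₁ : HasDerivAt D₁ d₂ x) (hd₂ : 0 ≤ d₂) (h2 : D₁ x ≤ 1) (h3 : 1 - D₁ x ≤ 1 / 64) :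
    W x < 0 ∧ U x ≤ 2 * W x ^ 2 ∧
      W x ^ 2 ≤ 2 * (U x - W x ^ 2) ∧ 64 * (2 * W x ^ 2 - U x) ≤ W x ^ 2 ∧
      ∃ u' : ℝ, HasDerivAt U u' x ∧ 4 * W x * (U x - W x ^ 2) - u' ≤ 0 := by
  -- `W' = D₁/D²` on `(X, ∞)`, hence `U = (D₁ + 1)/D²` there
  have hWd : ∀ y, X < y → HasDerivAt W (D₁ y / D y ^ 2) y := by
    intro y hy
    have h := (hasDerivAt_const y (-1 : ℝ)).div (hD y hy) (hpos y hy).ne'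
    have h' : HasDerivAt (fun z => -1 / D z) (D₁ y / D y ^ 2) y := by
      refine h.congr_deriv ?_
      ring
    refine h'.congr_of_eventuallyEq ?_
    filter_upwards [Ioi_mem_nhds hy] with z hz using hW z hz
  have hU : ∀ y, X < y → U y = (D₁ y + 1) / D y ^ 2 := by
    intro y hy
    have huniq := (hWU y hy).unique (hWd y hy)
    have : U y = D₁ y / D y ^ 2 + W y ^ 2 := by linarith
    rw [this, hW y hy, div_pow, neg_one_sq, ← add_div]
  -- the derivative of `U` at `x`
  have hDx := hpos x hx
  have hD2 : HasDerivAt (fun z => D z ^ 2) (2 * D x * D₁ x) x := by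
    have h := (hD x hx).pow 2
    refine h.congr_deriv ?_
    norm_num
  have hUd : HasDerivAt (fun z => (D₁ z + 1) / D z ^ 2)
      ((d₂ * D x ^ 2 - (D₁ x + 1) * (2 * D x * D₁ x)) / (D x ^ 2) ^ 2) x :=
    (hD₁.add_const 1).div hD2 (pow_ne_zero 2 hDx.ne')
  have hUev : U =ᶠ[𝓝 x] fun z => (D₁ z + 1) / D z ^ 2 := by
    filter_upwards [Ioi_mem_nhds hx] with z hz using hU z hz
  have hUx := hUd.congr_of_eventuallyEq hUev
  have hWx : W x = -1 / D x := hW x hx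
  have hUxe : U x = (D₁ x + 1) / D x ^ 2 := hU x hx
  have hD2pos : 0 < D x ^ 2 := by positivity
  refine ⟨?_, ?_, ?_, ?_, ⟨_, hUx, ?_⟩⟩
  · rw [hWx]
    exact div_neg_of_neg_of_pos (by norm_num) hDx
  · rw [hWx, hUxe, div_pow, neg_one_sq, mul_one_div]
    exact div_le_div_of_nonneg_right (by linarith) hD2pos.le
  · rw [hWx, hUxe, div_pow, neg_one_sq]
    rw [show 2 * ((D₁ x + 1) / D x ^ 2 - 1 / D x ^ 2) = (2 * D₁ x) / D x ^ 2 by ring]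
    exact div_le_div_of_nonneg_right (by linarith) hD2pos.le
  · rw [hWx, hUxe, div_pow, neg_one_sq]
    rw [show 64 * (2 * (1 / D x ^ 2) - (D₁ x + 1) / D x ^ 2) = (64 * (1 - D₁ x)) / D x ^ 2 by ring]
    exact div_le_div_of_nonneg_right (by linarith) hD2pos.le
  · have key : 4 * W x * (U x - W x ^ 2) -
        (d₂ * D x ^ 2 - (D₁ x + 1) * (2 * D x * D₁ x)) / (D x ^ 2) ^ 2 =
        -((2 * D₁ x * (1 - D₁ x) + d₂ * D x) / D x ^ 3) := by
      rw [hWx, hUxe]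
      field_simp
      ring
    rw [key, neg_nonpos]
    refine div_nonneg (add_nonneg ?_ (mul_nonneg hd₂ hDx.le)) (pow_nonneg hDx.le 3)
    exact mul_nonneg (mul_nonneg (by norm_num) (by linarith)) (by linarith)

/-- **Stub `stub_shiftFromCoeffs`** (Theorems B+D of the line `crum-peeling-recessive-tower`).
Let `r` be a tortoise radius function, `R ≥ 1`, and let `G`, `Ω` be real coefficient sequences
with `G₀ = Ω₀ = 1`, `|G₁| ≤ R`, `|Gₙ| ≤ Rⁿ⁻¹` (`n ≥ 2`), `|Ωₙ| ≤ Rⁿ`, inverse to each other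
(`∑ᵢ Gᵢ Ω_{n−i} = [n = 0]`).  If on a half-line `(X, ∞)` with `r ≥ 200 R M` the function
`W = −(1/r) · ∑ Ωₙ (M/r)ⁿ` solves `W' = U − W²`, then for every `x > X`:
`W < 0`, `U ≤ 2W²`, `W² ≤ 2(U − W²)`, `64(2W² − U) ≤ W²`, and `U` is differentiable at `x` with
`4W(U − W²) − U' ≤ 0`.  Proof: `W = −1/D`, `D = r · 𝐠(M/r)`, `𝐠 = ∑ Gₙ zⁿ = 1/∑ Ωₙ zⁿ`
(Cauchy product), `D' = (1 − 2w) 𝒟𝐠(w)` with `|𝒟𝐠(w) − 1| ≤ w/100`, `w = M/r ≤ 1/200`, and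
`D'' = (w/r)(1 − 2w)(2𝒟𝐠 − (1 − 2w)𝒟𝐠') ≥ 0`; then `sfc_translate`. -/
theorem stub_shiftFromCoeffs :
    ∀ (M R : ℝ) (r : ℝ → ℝ) (xc : ℝ), IsTortoiseRadius M r xc → 1 ≤ R →
      ∀ (G Ω : ℕ → ℝ), G 0 = 1 → Ω 0 = 1 → |G 1| ≤ R → (∀ n, 2 ≤ n → |G n| ≤ R ^ (n - 1)) →
      (∀ n, |Ω n| ≤ R ^ n) →
      (∀ n, ∑ i ∈ Finset.range (n + 1), G i * Ω (n - i) = if n = 0 then 1 else 0) →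
      ∀ (W U : ℝ → ℝ) (X : ℝ), (∀ x, X < x → 200 * R * M ≤ r x) →
        (∀ x, X < x → W x = -(1 / r x) * ∑' n, Ω n * (M / r x) ^ n) →
        (∀ x, X < x → HasDerivAt W (U x - W x ^ 2) x) →
        ∀ x, X < x →
          W x < 0 ∧ U x ≤ 2 * W x ^ 2 ∧
          W x ^ 2 ≤ 2 * (U x - W x ^ 2) ∧ 64 * (2 * W x ^ 2 - U x) ≤ W x ^ 2 ∧
          ∃ u' : ℝ, HasDerivAt U u' x ∧ 4 * W x * (U x - W x ^ 2) - u' ≤ 0 := by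
  intro M R r xc hr hR G Ω hG0 _hΩ0 hG1 hG hΩ hinv W U X hfar hWrep hWU x hx
  have hM := hr.mass_pos
  have hR0 : 0 < R := by linarith
  have hGR : ∀ n, |G n| ≤ R ^ n := sfc_coeff_le hR hG0 hG1 hG
  -- `w = M/r ∈ [0, 1/(200R)]` on `(X, ∞)`
  have hw0 : ∀ y, 0 ≤ M / r y := fun y => (div_pos hM (hr.pos y)).le
  have hw : ∀ y, X < y → R * (M / r y) ≤ 1 / 200 := by
    intro y hy
    have h := hfar y hy
    rw [mul_div_assoc', div_le_iff₀ (hr.pos y)]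
    linarith
  -- the series `𝐠`, `𝒟𝐠` and the functions `D`, `D₁`
  obtain ⟨g, hg⟩ : ∃ g : ℝ → ℝ, g = fun z => ∑' n, G n * z ^ n := ⟨_, rfl⟩
  obtain ⟨dg, hdg⟩ : ∃ dg : ℝ → ℝ, dg = fun z => ∑' n : ℕ, (1 - (n : ℝ)) * G n * z ^ n := ⟨_, rfl⟩
  have hpt : ∀ y, X < y → ∃ g₁ d₁ : ℝ, HasDerivAt g g₁ (M / r y) ∧ HasDerivAt dg d₁ (M / r y) ∧
      dg (M / r y) = g (M / r y) - M / r y * g₁ ∧ |g (M / r y) - 1| ≤ 1 / 100 ∧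
      |dg (M / r y) - 1| ≤ M / r y / 100 ∧ |d₁| ≤ 1 / 50 := by
    intro y hy
    subst hg hdg
    exact sfc_point hR hG0 hG1 hG (hw0 y) (hw y hy)
  obtain ⟨D, hD⟩ : ∃ D : ℝ → ℝ, D = fun y => r y * g (M / r y) := ⟨_, rfl⟩
  obtain ⟨D₁, hD₁⟩ : ∃ D₁ : ℝ → ℝ, D₁ = fun y => (1 - 2 * (M / r y)) * dg (M / r y) := ⟨_, rfl⟩
  -- `D' = D₁`, `D > 0`, `W = −1/D` on `(X, ∞)`
  have hDd : ∀ y, X < y → HasDerivAt D (D₁ y) y := by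
    intro y hy
    obtain ⟨g₁, d₁, hg₁, -, hrel, -⟩ := hpt y hy
    rw [hD, hD₁]
    exact sfc_hasDerivAt_D hr g dg hg₁ hrel
  have hglow : ∀ y, X < y → 99 / 100 ≤ g (M / r y) := by
    intro y hy
    obtain ⟨_, _, -, -, -, hgb, -⟩ := hpt y hy
    have := (abs_le.1 hgb).1
    linarith
  have hDpos : ∀ y, X < y → 0 < D y := by
    intro y hy
    rw [hD]
    exact mul_pos (hr.pos y) (by linarith [hglow y hy])
  have hWD : ∀ y, X < y → W y = -1 / D y := by
    intro y hy
    have hgy : 0 < g (M / r y) := by linarith [hglow y hy]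
    have habs : |M / r y| = M / r y := abs_of_nonneg (hw0 y)
    have hlt : R * |M / r y| < 1 := by rw [habs]; linarith [hw y hy]
    have hprod : g (M / r y) * ∑' n, Ω n * (M / r y) ^ n = 1 := by
      rw [hg]
      exact sfc_tsum_mul_tsum_eq_one (sfc_summable_norm_pow hR0.le hlt hGR)
        (sfc_summable_norm_pow hR0.le hlt hΩ) hinv
    have hS : ∑' n, Ω n * (M / r y) ^ n = 1 / g (M / r y) := by
      rw [eq_div_iff hgy.ne', mul_comm]
      exact hprod
    rw [hWrep y hy, hS, hD]
    have hry : r y ≠ 0 := (hr.pos y).ne'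
    field_simp
  -- at the point `x`: the bounds on `D₁ x` and `D'' x ≥ 0`
  obtain ⟨g₁, d₁, -, hd₁, -, -, hdgb, hd₁b⟩ := hpt x hx
  have hD₁d : HasDerivAt D₁ (M / r x / r x * (1 - 2 * (M / r x)) *
      (2 * dg (M / r x) - (1 - 2 * (M / r x)) * d₁)) x := by
    rw [hD₁]
    exact sfc_hasDerivAt_D₁ hr dg hd₁
  have hwx0 : 0 ≤ M / r x := hw0 x
  have hwx : M / r x ≤ 1 / 200 := by
    have h := hw x hx
    nlinarith
  have hdg1 := (abs_le.1 hdgb).1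
  have hdg2 := (abs_le.1 hdgb).2
  have hd11 := (abs_le.1 hd₁b).1
  have hd12 := (abs_le.1 hd₁b).2
  have h12w : 0 ≤ 1 - 2 * (M / r x) := by linarith
  have hD₁x : D₁ x = (1 - 2 * (M / r x)) * dg (M / r x) := by rw [hD₁]
  have hb2 : D₁ x ≤ 1 := by
    rw [hD₁x]
    nlinarith [mul_le_mul_of_nonneg_left hdg2 h12w]
  have hb3 : 1 - D₁ x ≤ 1 / 64 := by
    rw [hD₁x]
    nlinarith [mul_le_mul_of_nonneg_left hdg1 h12w]
  have hd₂ : 0 ≤ M / r x / r x * (1 - 2 * (M / r x)) *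
      (2 * dg (M / r x) - (1 - 2 * (M / r x)) * d₁) := by
    refine mul_nonneg (mul_nonneg (div_nonneg hwx0 (hr.pos x).le) h12w) ?_
    nlinarith [mul_le_mul_of_nonneg_left hd12 h12w]
  exact sfc_translate hx hDd hDpos hWD hWU hD₁d hd₂ hb2 hb3

end Summit.FinalStateConjecture.FinalStateConjecture.Theorems.CrumPeelingRecessiveTower
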